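import Mathlib
import Summits.CriticalPhenomena.CardyFormulaZ2.Theorems.CardyMagicRigidityNestingRigidityUVTiltTransfer
import HarnessLib

/-!
# Crux `NestingRigidity`, line `ring-cloud-tomography` (r5): pathwise domination of the BOUNDARY
# part of the additive UV statistic by collar loop statistics (tilt transfer, step 2)

Crux `Summit.CriticalPhenomena.CardyFormulaZ2.Theses.CardyMagicRigidity.NestingRigidity`
(stmt-CriticalPhenomena-4835), line `ring-cloud-tomography`, stub R1'
`stub_uvDecoupling : ∀ E ∈ latticeEnsembles, UVDecoupling E`.  By the exact independence split
(`integral_towerWeight_mul_uvPhase_eq_split`, …UVTiltTransfer) the tilt transfer behind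
hypothesis (L) of `uvDecoupling_of_tilted_moments` is the control, untilted and tilted, of the
BOUNDARY STATISTIC `Θ_B = Σ_{u ∈ B} θ_u`, `B` the non-tower loops of `X_δ(ω)` whose trace meets
`A* = B̄(0, 1 + 2δ) ∖ B(0, r − 2δ)`.  This file bounds `Θ_B` PATHWISE and deterministically (no
cited fact, no definition) by three COLLAR STATISTICS of the configuration:
`|Θ_B| ≤ |t| · (Σ_{u ∈ C_r} φ_u + #X + Σ_{u ∈ C_1} ψ_u)` (registered anchor
`abs_uvPhaseBd_le_collar_latticeEnsembles`), where
* `φ_u = ∫_{int u} ρ_{B(0,r)} ∈ [0,1]` and `ψ_u = ∫_{int u} σ_{0,1,2} ∈ [0,1]` are the disc and ring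
  fractions of the bite formula `θ_u = t(φ_u − ψ_u)` (`ConeTilt.cone_nestingPhase_eq`);
* `C_r = {u ∈ loops | u meets B̄(0,r) and leaves B(0, r − 2δ)}` — loops CROSSING THE INNER COLLAR;
* `X = {u ∈ loops | B̄(0,r) ⊆ int u, u leaves B(0,1), u meets B̄(0, 1 + 2δ)}` — EXIT LOOPS (they
  surround the disc and cross the outer collar `{1 ≤ |z| ≤ 1 + 2δ}`);
* `C_1 = {u ∈ loops | u meets B̄(0, 1 + 2δ) and leaves B(0,1)}` — loops CROSSING THE OUTER COLLAR.
Indeed (§1) a boundary loop with `φ_u ≠ 0` winds around a point of `B(0,r)`: either its trace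
meets `B̄(0,r)` (then `u ∈ C_r`, as it also meets `A*`), or the winding number is constant `≠ 0` on
`B̄(0,r)` and, `u` not being a tower loop, `u ∈ X`; a boundary loop with `ψ_u ≠ 0` is not inside
`B(0,1)` and meets `A* ⊆ B̄(0, 1 + 2δ)`, so `u ∈ C_1`.  §2 sums the termwise bound over the finite
family of loops meeting `B̄(0, 1 + 2δ)` (both lattices), and records the measurability and the
uniform bounds of the three collar statistics (their tilted and untilted first moments are the
remaining RSW inputs of (L): `E Σ_{C_r} φ_u = O(1)` because `φ_u ≤ diam(u)²/r²`, §3).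
-/

noncomputable section

open MeasureTheory ProbabilityTheory Set Filter Metric
open scoped Real Topology BigOperators

namespace Summit.CriticalPhenomena.CardyFormulaZ2.Cruxes.NestingRigidity.RingCloudTomography

open Literature.Probability.RandomPlanarGeometry Literature.Probability.Percolation
  Literature.Probability.LatticeModels
open Summit.CriticalPhenomena.CardyFormulaZ2.Cruxes.NestingRigidity.PositiveConeWeightDoubling
  (magicWeight meanTower coneCloud)

namespace TiltTransfer

/-! ## §1 Per-loop facts: the bite bound and the classification of contributing boundary loops -/

/-- **Bite bound**: `|θ_u| ≤ |t|·(φ_u + ψ_u)` for every loop (`θ_u = t(φ_u − ψ_u)`, both fractions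
in `[0, 1]`). -/
theorem abs_cone_nestingPhase_le_add {t r : ℝ} (hr : 0 < r) (u : UnbasedLoop ℂ) :
    |u.nestingPhase (coneCloud t r).density| ≤
      |t| * ((∫ z in {z | u.wind z ≠ 0}, discDensity 0 r z) +
        ∫ z in {z | u.wind z ≠ 0}, annulusDensity 0 1 2 z) := by
  rw [ConeTilt.cone_nestingPhase_eq (𝔠 := coneCloud t r) rfl u, abs_mul]
  refine mul_le_mul_of_nonneg_left (abs_le.2 ⟨?_, ?_⟩) (abs_nonneg t)
  · linarith [(ConeTilt.setIntegral_discDensity_mem_Icc 0 hr {z | u.wind z ≠ 0}).1]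
  · linarith [(ConeTilt.setIntegral_annulusDensity_mem_Icc 0 one_pos one_lt_two
      {z | u.wind z ≠ 0}).1]

/-- **Boundary loops biting the disc cross the inner collar or are exit loops.**  If a non-tower
loop whose trace meets `A* = B̄(0, 1 + 2δ) ∖ B(0, r − 2δ)` has `φ_u ≠ 0`, then either its trace
meets `B̄(0, r)` (and leaves `B(0, r − 2δ)`), or `B̄(0, r) ⊆ int u`, the trace leaves `B(0, 1)` and
meets `B̄(0, 1 + 2δ)` (the winding number is constant on the closed disc missed by the trace). -/
theorem mem_collar_or_exit_of_discFrac_ne_zero {c : LoopConfig ℂ} {u : UnbasedLoop ℂ} {r δ : ℝ}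
    (hu : u ∈ {u ∈ c.loops |
      ¬ Disjoint u.range (closedBall (0 : ℂ) (1 + 2 * δ) \ ball 0 (r - 2 * δ)) ∧
        ¬ (closedBall (0 : ℂ) r ⊆ {z | u.wind z ≠ 0} ∧ u.range ⊆ ball (0 : ℂ) 1)})
    (hφ : ∫ z in {z | u.wind z ≠ 0}, discDensity 0 r z ≠ 0) :
    u ∈ {u ∈ c.loops | (u.range ∩ closedBall (0 : ℂ) r).Nonempty ∧
        ¬ u.range ⊆ ball (0 : ℂ) (r - 2 * δ)} ∨
      u ∈ {u ∈ c.loops | closedBall (0 : ℂ) r ⊆ {z | u.wind z ≠ 0} ∧ ¬ u.range ⊆ ball (0 : ℂ) 1 ∧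
        (u.range ∩ closedBall (0 : ℂ) (1 + 2 * δ)).Nonempty} := by
  obtain ⟨huL, hA, hT⟩ := hu
  obtain ⟨p, hp, hpA⟩ := Set.not_disjoint_iff.1 hA
  have hz : ¬ Disjoint {z | u.wind z ≠ 0} (ball (0 : ℂ) r) := fun h ↦
    hφ (ConeTilt.setIntegral_discDensity_eq_zero 0 r h)
  obtain ⟨z, hzw, hzr⟩ := Set.not_disjoint_iff.1 hz
  by_cases hmeet : (u.range ∩ closedBall (0 : ℂ) r).Nonempty
  · exact Or.inl ⟨huL, hmeet, fun h ↦ hpA.2 (h hp)⟩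
  · right
    have hdisj : Disjoint u.range (closedBall (0 : ℂ) r) :=
      Set.disjoint_iff_inter_eq_empty.2 (Set.not_nonempty_iff_eq_empty.1 hmeet)
    have hwind : closedBall (0 : ℂ) r ⊆ {w | u.wind w ≠ 0} := fun w hw ↦ by
      rw [mem_setOf_eq, u.wind_eq_wind_of_disjoint hdisj hw (ball_subset_closedBall hzr)]
      exact hzw
    exact ⟨huL, hwind, fun h ↦ hT ⟨hwind, h⟩, p, hp, hpA.1⟩

/-- **Boundary loops biting the ring cross the outer collar**: a loop whose trace meets `A*` and
with `ψ_u ≠ 0` meets `B̄(0, 1 + 2δ)` and leaves `B(0, 1)` (inner loops never bite the ring). -/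
theorem mem_unitCollar_of_ringFrac_ne_zero {c : LoopConfig ℂ} {u : UnbasedLoop ℂ} {r δ : ℝ}
    (hu : u ∈ {u ∈ c.loops |
      ¬ Disjoint u.range (closedBall (0 : ℂ) (1 + 2 * δ) \ ball 0 (r - 2 * δ)) ∧
        ¬ (closedBall (0 : ℂ) r ⊆ {z | u.wind z ≠ 0} ∧ u.range ⊆ ball (0 : ℂ) 1)})
    (hψ : ∫ z in {z | u.wind z ≠ 0}, annulusDensity 0 1 2 z ≠ 0) :
    u ∈ {u ∈ c.loops | (u.range ∩ closedBall (0 : ℂ) (1 + 2 * δ)).Nonempty ∧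
      ¬ u.range ⊆ ball (0 : ℂ) 1} := by
  obtain ⟨huL, hA, -⟩ := hu
  obtain ⟨p, hp, hpA⟩ := Set.not_disjoint_iff.1 hA
  exact ⟨huL, ⟨p, hp, hpA.1⟩, fun h ↦
    hψ (ConeTilt.setIntegral_annulusDensity_eq_zero_of_range_subset h le_rfl 2)⟩

/-- **Termwise bound.**  For EVERY loop `u`: the boundary contribution `[u ∈ B]·|θ_u|` is at most
`|t|·([u ∈ C_r]·φ_u + [u ∈ X] + [u ∈ C_1]·ψ_u)` (indicators of the four families). -/
theorem abs_indicator_bd_le {c : LoopConfig ℂ} {t r δ : ℝ} (hr : 0 < r) (u : UnbasedLoop ℂ) :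
    |Set.indicator {u ∈ c.loops |
        ¬ Disjoint u.range (closedBall (0 : ℂ) (1 + 2 * δ) \ ball 0 (r - 2 * δ)) ∧
          ¬ (closedBall (0 : ℂ) r ⊆ {z | u.wind z ≠ 0} ∧ u.range ⊆ ball (0 : ℂ) 1)}
        (fun u ↦ u.nestingPhase (coneCloud t r).density) u| ≤
      |t| * (Set.indicator {u ∈ c.loops | (u.range ∩ closedBall (0 : ℂ) r).Nonempty ∧
            ¬ u.range ⊆ ball (0 : ℂ) (r - 2 * δ)}
          (fun u ↦ ∫ z in {z | u.wind z ≠ 0}, discDensity 0 r z) u +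
        Set.indicator {u ∈ c.loops | closedBall (0 : ℂ) r ⊆ {z | u.wind z ≠ 0} ∧
            ¬ u.range ⊆ ball (0 : ℂ) 1 ∧ (u.range ∩ closedBall (0 : ℂ) (1 + 2 * δ)).Nonempty}
          (fun _ ↦ (1 : ℝ)) u +
        Set.indicator {u ∈ c.loops | (u.range ∩ closedBall (0 : ℂ) (1 + 2 * δ)).Nonempty ∧
            ¬ u.range ⊆ ball (0 : ℂ) 1}
          (fun u ↦ ∫ z in {z | u.wind z ≠ 0}, annulusDensity 0 1 2 z) u) := by
  have hφ := ConeTilt.setIntegral_discDensity_mem_Icc 0 hr {z | u.wind z ≠ 0}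
  have hψ := ConeTilt.setIntegral_annulusDensity_mem_Icc 0 one_pos one_lt_two {z | u.wind z ≠ 0}
  have hCn : 0 ≤ Set.indicator {u ∈ c.loops | (u.range ∩ closedBall (0 : ℂ) r).Nonempty ∧
      ¬ u.range ⊆ ball (0 : ℂ) (r - 2 * δ)}
      (fun u : UnbasedLoop ℂ ↦ ∫ z in {z | u.wind z ≠ 0}, discDensity 0 r z) u :=
    Set.indicator_nonneg (fun v _ ↦ (ConeTilt.setIntegral_discDensity_mem_Icc 0 hr _).1) u
  have hXn : 0 ≤ Set.indicator {u ∈ c.loops | closedBall (0 : ℂ) r ⊆ {z | u.wind z ≠ 0} ∧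
      ¬ u.range ⊆ ball (0 : ℂ) 1 ∧ (u.range ∩ closedBall (0 : ℂ) (1 + 2 * δ)).Nonempty}
      (fun _ : UnbasedLoop ℂ ↦ (1 : ℝ)) u :=
    Set.indicator_nonneg (fun _ _ ↦ zero_le_one) u
  have hC1n : 0 ≤ Set.indicator {u ∈ c.loops | (u.range ∩ closedBall (0 : ℂ) (1 + 2 * δ)).Nonempty ∧
      ¬ u.range ⊆ ball (0 : ℂ) 1}
      (fun u : UnbasedLoop ℂ ↦ ∫ z in {z | u.wind z ≠ 0}, annulusDensity 0 1 2 z) u :=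
    Set.indicator_nonneg
      (fun v _ ↦ (ConeTilt.setIntegral_annulusDensity_mem_Icc 0 one_pos one_lt_two _).1) u
  by_cases hB : u ∈ {u ∈ c.loops |
      ¬ Disjoint u.range (closedBall (0 : ℂ) (1 + 2 * δ) \ ball 0 (r - 2 * δ)) ∧
        ¬ (closedBall (0 : ℂ) r ⊆ {z | u.wind z ≠ 0} ∧ u.range ⊆ ball (0 : ℂ) 1)}
  · rw [Set.indicator_of_mem hB]
    refine (abs_cone_nestingPhase_le_add hr u).trans (mul_le_mul_of_nonneg_left ?_ (abs_nonneg t))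
    have h1 : ∫ z in {z | u.wind z ≠ 0}, discDensity 0 r z ≤
        Set.indicator {u ∈ c.loops | (u.range ∩ closedBall (0 : ℂ) r).Nonempty ∧
            ¬ u.range ⊆ ball (0 : ℂ) (r - 2 * δ)}
          (fun u : UnbasedLoop ℂ ↦ ∫ z in {z | u.wind z ≠ 0}, discDensity 0 r z) u +
        Set.indicator {u ∈ c.loops | closedBall (0 : ℂ) r ⊆ {z | u.wind z ≠ 0} ∧
            ¬ u.range ⊆ ball (0 : ℂ) 1 ∧ (u.range ∩ closedBall (0 : ℂ) (1 + 2 * δ)).Nonempty}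
          (fun _ : UnbasedLoop ℂ ↦ (1 : ℝ)) u := by
      by_cases hφ0 : ∫ z in {z | u.wind z ≠ 0}, discDensity 0 r z = 0
      · rw [hφ0]
        exact add_nonneg hCn hXn
      · rcases mem_collar_or_exit_of_discFrac_ne_zero hB hφ0 with hC | hX
        · rw [Set.indicator_of_mem hC]
          linarith
        · rw [Set.indicator_of_mem hX]
          linarith [hφ.2]
    have h2 : ∫ z in {z | u.wind z ≠ 0}, annulusDensity 0 1 2 z ≤
        Set.indicator {u ∈ c.loops | (u.range ∩ closedBall (0 : ℂ) (1 + 2 * δ)).Nonempty ∧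
            ¬ u.range ⊆ ball (0 : ℂ) 1}
          (fun u : UnbasedLoop ℂ ↦ ∫ z in {z | u.wind z ≠ 0}, annulusDensity 0 1 2 z) u := by
      by_cases hψ0 : ∫ z in {z | u.wind z ≠ 0}, annulusDensity 0 1 2 z = 0
      · rw [hψ0]
        exact hC1n
      · rw [Set.indicator_of_mem (mem_unitCollar_of_ringFrac_ne_zero hB hψ0)]
    linarith
  · rw [Set.indicator_of_notMem hB, abs_zero]
    exact mul_nonneg (abs_nonneg t) (add_nonneg (add_nonneg hCn hXn) hC1n)

/-! ## §2 Summation over the loops meeting `B̄(0, 1 + 2δ)` -/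

/-- A finitary sum over a subset `s` of a finite set `M`, written as the sum of the
`s`-indicator over `M`. -/
theorem finsum_mem_eq_sum_indicator {α : Type*} {M s : Set α} (hM : M.Finite) (hs : s ⊆ M)
    (g : α → ℝ) : ∑ᶠ a ∈ s, g a = ∑ a ∈ hM.toFinset, s.indicator g a := by
  rw [finsum_mem_def]
  refine finsum_eq_sum_of_support_subset _ fun a ha ↦ ?_
  rw [hM.coe_toFinset]
  exact hs (Set.support_indicator_subset ha)

/-- The cardinality of a subset `s` of a finite set `M` as the sum of its indicator over `M`. -/
theorem ncard_eq_sum_indicator {α : Type*} {M s : Set α} (hM : M.Finite) (hs : s ⊆ M) :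
    (s.ncard : ℝ) = ∑ a ∈ hM.toFinset, s.indicator (fun _ ↦ (1 : ℝ)) a := by
  rw [← finsum_mem_eq_sum_indicator hM hs, FirstMoment.finsum_mem_const_eq, mul_one]

/-- **The pathwise collar bound, for a configuration with finitely many loops meeting
`B̄(0, 1 + 2δ)`** (`0 < r ≤ 1`, `0 ≤ δ`): `|Θ_B| ≤ |t| · (Σ_{u ∈ C_r} φ_u + #X + Σ_{u ∈ C_1} ψ_u)`. -/
theorem abs_uvPhaseBd_le_collar (c : LoopConfig ℂ) {t r δ : ℝ} (hr : 0 < r) (hr1 : r ≤ 1)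
    (hδ : 0 ≤ δ)
    (hfin : {u ∈ c.loops | (u.range ∩ closedBall (0 : ℂ) (1 + 2 * δ)).Nonempty}.Finite) :
    |∑ᶠ u ∈ {u ∈ c.loops |
        ¬ Disjoint u.range (closedBall (0 : ℂ) (1 + 2 * δ) \ ball 0 (r - 2 * δ)) ∧
          ¬ (closedBall (0 : ℂ) r ⊆ {z | u.wind z ≠ 0} ∧ u.range ⊆ ball (0 : ℂ) 1)},
        u.nestingPhase (coneCloud t r).density| ≤
      |t| * ((∑ᶠ u ∈ {u ∈ c.loops | (u.range ∩ closedBall (0 : ℂ) r).Nonempty ∧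
            ¬ u.range ⊆ ball (0 : ℂ) (r - 2 * δ)}, ∫ z in {z | u.wind z ≠ 0}, discDensity 0 r z) +
        ({u ∈ c.loops | closedBall (0 : ℂ) r ⊆ {z | u.wind z ≠ 0} ∧ ¬ u.range ⊆ ball (0 : ℂ) 1 ∧
            (u.range ∩ closedBall (0 : ℂ) (1 + 2 * δ)).Nonempty}.ncard : ℝ) +
        ∑ᶠ u ∈ {u ∈ c.loops | (u.range ∩ closedBall (0 : ℂ) (1 + 2 * δ)).Nonempty ∧
            ¬ u.range ⊆ ball (0 : ℂ) 1}, ∫ z in {z | u.wind z ≠ 0}, annulusDensity 0 1 2 z) := by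
  set M := {u ∈ c.loops | (u.range ∩ closedBall (0 : ℂ) (1 + 2 * δ)).Nonempty}
  -- the four families lie in `M`
  have hB : {u ∈ c.loops |
      ¬ Disjoint u.range (closedBall (0 : ℂ) (1 + 2 * δ) \ ball 0 (r - 2 * δ)) ∧
        ¬ (closedBall (0 : ℂ) r ⊆ {z | u.wind z ≠ 0} ∧ u.range ⊆ ball (0 : ℂ) 1)} ⊆ M := by
    rintro u ⟨hu, hA, -⟩
    obtain ⟨p, hp, hpA⟩ := Set.not_disjoint_iff.1 hA
    exact ⟨hu, p, hp, hpA.1⟩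
  have hC : {u ∈ c.loops | (u.range ∩ closedBall (0 : ℂ) r).Nonempty ∧
      ¬ u.range ⊆ ball (0 : ℂ) (r - 2 * δ)} ⊆ M := by
    rintro u ⟨hu, ⟨p, hp, hpr⟩, -⟩
    exact ⟨hu, p, hp, closedBall_subset_closedBall (by linarith) hpr⟩
  have hX : {u ∈ c.loops | closedBall (0 : ℂ) r ⊆ {z | u.wind z ≠ 0} ∧ ¬ u.range ⊆ ball (0 : ℂ) 1 ∧
      (u.range ∩ closedBall (0 : ℂ) (1 + 2 * δ)).Nonempty} ⊆ M := fun u hu ↦ ⟨hu.1, hu.2.2.2⟩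
  have hC1 : {u ∈ c.loops | (u.range ∩ closedBall (0 : ℂ) (1 + 2 * δ)).Nonempty ∧
      ¬ u.range ⊆ ball (0 : ℂ) 1} ⊆ M := fun u hu ↦ ⟨hu.1, hu.2.1⟩
  rw [finsum_mem_eq_sum_indicator hfin hB, finsum_mem_eq_sum_indicator hfin hC,
    ncard_eq_sum_indicator hfin hX, finsum_mem_eq_sum_indicator hfin hC1, ← Finset.sum_add_distrib,
    ← Finset.sum_add_distrib, Finset.mul_sum]
  exact (Finset.abs_sum_le_sum_abs _ _).trans (Finset.sum_le_sum fun u _ ↦ abs_indicator_bd_le hr u)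

/-! ## §3 Small loops bite little: `φ_u ≤ ρ²/r²`, `ψ_u ≤ ρ²/3` -/

/-- The area of a closed disc of radius `ρ ≥ 0` in `ℂ` is `π ρ²`. -/
theorem volume_real_closedBall (x : ℂ) {ρ : ℝ} (hρ : 0 ≤ ρ) :
    volume.real (closedBall x ρ) = π * ρ ^ 2 := by
  rw [measureReal_def, Complex.volume_closedBall, ENNReal.toReal_mul, ENNReal.toReal_pow,
    ENNReal.toReal_ofReal hρ, ENNReal.coe_toReal, NNReal.coe_real_pi, mul_comm]

/-- **Disc fraction of a small loop**: if the winding interior lies in a closed disc of radius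
`ρ`, then `φ_u = |int u ∩ B(0,r)|/(π r²) ≤ ρ²/r²`. -/
theorem setIntegral_discDensity_le_sq_div (u : UnbasedLoop ℂ) {r : ℝ} (hr : 0 < r) {x : ℂ}
    {ρ : ℝ} (hρ : 0 ≤ ρ) (hU : {z | u.wind z ≠ 0} ⊆ closedBall x ρ) :
    ∫ z in {z | u.wind z ≠ 0}, discDensity 0 r z ≤ ρ ^ 2 / r ^ 2 := by
  unfold discDensity
  rw [setIntegral_indicator measurableSet_ball, setIntegral_const, smul_eq_mul]
  have hle : volume.real ({z | u.wind z ≠ 0} ∩ ball (0 : ℂ) r) ≤ π * ρ ^ 2 := by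
    rw [← volume_real_closedBall x hρ]
    exact measureReal_mono (Set.inter_subset_left.trans hU) measure_closedBall_lt_top.ne
  calc volume.real ({z | u.wind z ≠ 0} ∩ ball (0 : ℂ) r) * (π * r ^ 2)⁻¹
      ≤ π * ρ ^ 2 * (π * r ^ 2)⁻¹ := mul_le_mul_of_nonneg_right hle (by positivity)
    _ = ρ ^ 2 / r ^ 2 := by field_simp

/-- **Ring fraction of a small loop**: if the winding interior lies in a closed disc of radius
`ρ`, then `ψ_u = |int u ∩ A(1,2)|/(3π) ≤ ρ²/3`. -/
theorem setIntegral_annulusDensity_le_sq_div (u : UnbasedLoop ℂ) {x : ℂ} {ρ : ℝ} (hρ : 0 ≤ ρ)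
    (hU : {z | u.wind z ≠ 0} ⊆ closedBall x ρ) :
    ∫ z in {z | u.wind z ≠ 0}, annulusDensity 0 1 2 z ≤ ρ ^ 2 / 3 := by
  unfold annulusDensity
  rw [setIntegral_indicator (CloudAdmissibility.measurableSet_annulus 0 1 2), setIntegral_const,
    smul_eq_mul]
  have hle : volume.real ({z | u.wind z ≠ 0} ∩ {z : ℂ | (1 : ℝ) ≤ ‖z - 0‖ ∧ ‖z - 0‖ < 2}) ≤
      π * ρ ^ 2 := by
    rw [← volume_real_closedBall x hρ]
    exact measureReal_mono (Set.inter_subset_left.trans hU) measure_closedBall_lt_top.ne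
  calc volume.real ({z | u.wind z ≠ 0} ∩ {z : ℂ | (1 : ℝ) ≤ ‖z - 0‖ ∧ ‖z - 0‖ < 2}) *
        (π * ((2 : ℝ) ^ 2 - 1 ^ 2))⁻¹
      ≤ π * ρ ^ 2 * (π * ((2 : ℝ) ^ 2 - 1 ^ 2))⁻¹ :=
        mul_le_mul_of_nonneg_right hle (by norm_num; positivity)
    _ = ρ ^ 2 / 3 := by field_simp; ring

/-- **Small loops crossing the inner collar bite little**: for every loop `u` and every point `x`
of its trace, `φ_u ≤ diam(trace u)²/r²` (the interior lies in `B̄(x, diam)`,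
`UnbasedLoop.setOf_wind_ne_zero_subset_closedBall`); with `φ_u ≤ 1` this is the summable weight
`min(1, diam²/r²)` behind `E Σ_{C_r} φ_u = O(1)`. -/
theorem discFrac_le_diam_sq_div (u : UnbasedLoop ℂ) {r : ℝ} (hr : 0 < r) {x : ℂ} (hx : x ∈ u.range) :
    ∫ z in {z | u.wind z ≠ 0}, discDensity 0 r z ≤ diam u.range ^ 2 / r ^ 2 :=
  setIntegral_discDensity_le_sq_div u hr diam_nonneg (u.setOf_wind_ne_zero_subset_closedBall hx)

/-- **Small loops crossing the outer collar bite little**: `ψ_u ≤ diam(trace u)²/3`. -/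
theorem ringFrac_le_diam_sq_div (u : UnbasedLoop ℂ) {x : ℂ} (hx : x ∈ u.range) :
    ∫ z in {z | u.wind z ≠ 0}, annulusDensity 0 1 2 z ≤ diam u.range ^ 2 / 3 :=
  setIntegral_annulusDensity_le_sq_div u diam_nonneg (u.setOf_wind_ne_zero_subset_closedBall hx)

end TiltTransfer

/-- **Pathwise domination of the boundary part of the UV statistic by collar loop statistics, on
BOTH lattice ensembles** (registered helper toward stub R1' `stub_uvDecoupling`, line
`ring-cloud-tomography` r5).  For `E ∈ latticeEnsembles`, mesh `δ > 0`, every sample, charge `t`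
and `0 < r ≤ 1`: with `Θ_B = Σ_{u ∈ B} θ_u` the boundary part of the additive UV statistic `Θ` of
hypothesis (L) of `uvDecoupling_of_tilted_moments` (`B` = non-tower loops whose trace meets
`B̄(0, 1 + 2δ) ∖ B(0, r − 2δ)`; `E[w^N Θ] = E[w^N](E Θ − E Θ_B) + E[w^N Θ_B]` by
`integral_towerWeight_mul_uvPhase_eq_split`),
`|Θ_B| ≤ |t| · (Σ_{u ∈ C_r} φ_u + #X + Σ_{u ∈ C_1} ψ_u)`, where `φ_u`, `ψ_u ∈ [0,1]` are the disc and
ring fractions of the bite formula `θ_u = t(φ_u − ψ_u)`, `C_r` = loops meeting `B̄(0,r)` and leaving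
`B(0, r − 2δ)` (inner collar crossings), `X` = loops surrounding `B̄(0,r)`, leaving `B(0,1)` and
meeting `B̄(0, 1 + 2δ)` (exit loops), `C_1` = loops meeting `B̄(0, 1 + 2δ)` and leaving `B(0,1)`
(outer collar crossings).  Hence the tilt transfer of (L) follows from first-moment bounds on these
three collar statistics, untilted (`≤ C`) and tilted by `w^{N_0(r,1)}` (`≤ C·E[w^N]`). -/
theorem abs_uvPhaseBd_le_collar_latticeEnsembles : ∀ E ∈ latticeEnsembles, ∀ {δ : ℝ}, 0 < δ →
    ∀ (ω : E.Ω) (t : ℝ) {r : ℝ}, 0 < r → r ≤ 1 →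
    |∑ᶠ u ∈ {u ∈ (E.X δ ω).loops |
        ¬ Disjoint u.range (Metric.closedBall (0 : ℂ) (1 + 2 * δ) \ Metric.ball 0 (r - 2 * δ)) ∧
          ¬ (Metric.closedBall (0 : ℂ) r ⊆ {z | u.wind z ≠ 0} ∧ u.range ⊆ Metric.ball (0 : ℂ) 1)},
        u.nestingPhase (coneCloud t r).density| ≤
      |t| * ((∑ᶠ u ∈ {u ∈ (E.X δ ω).loops | (u.range ∩ Metric.closedBall (0 : ℂ) r).Nonempty ∧
            ¬ u.range ⊆ Metric.ball (0 : ℂ) (r - 2 * δ)},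
            ∫ z in {z | u.wind z ≠ 0}, discDensity 0 r z) +
        ({u ∈ (E.X δ ω).loops | Metric.closedBall (0 : ℂ) r ⊆ {z | u.wind z ≠ 0} ∧
            ¬ u.range ⊆ Metric.ball (0 : ℂ) 1 ∧
            (u.range ∩ Metric.closedBall (0 : ℂ) (1 + 2 * δ)).Nonempty}.ncard : ℝ) +
        ∑ᶠ u ∈ {u ∈ (E.X δ ω).loops | (u.range ∩ Metric.closedBall (0 : ℂ) (1 + 2 * δ)).Nonempty ∧
            ¬ u.range ⊆ Metric.ball (0 : ℂ) 1},
            ∫ z in {z | u.wind z ≠ 0}, annulusDensity 0 1 2 z) :=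
  fun E hE _ hδ ω _ _ hr hr1 ↦
    TiltTransfer.abs_uvPhaseBd_le_collar _ hr hr1 hδ.le (ConeTilt.finite_loops_meeting E hE hδ ω _)

end Summit.CriticalPhenomena.CardyFormulaZ2.Cruxes.NestingRigidity.RingCloudTomography

end
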